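import Literature.MathematicalPhysics.QuantumFieldTheory.Balaban1983to89.B9Eq335PlaquettesOfRegularCubeZd
import Literature.MathematicalPhysics.QuantumFieldTheory.Balaban1983to89.B9Eq327GreenZdHerm
import Literature.MathematicalPhysics.QuantumFieldTheory.Balaban1983to89.B8Eq138LandauZd

/-!
# `Balaban1983to89.B9Eq310TwistedBondDstarDZd` — [Balaban1985BackgroundPropagators] (3.4) p. 391, (3.9)–(3.10) p. 392 ∕ [Balaban1985RegularSpaces] (1.1)–(1.2)
# p. 76, (1.55) p. 86 ON THE `ℤᵈ × 𝔸` CARRIER, AT ONE TWISTED BOND: the background `U₀ = −1` on a single bond `b = ⟨z, z + e_ν⟩` (`= 1` elsewhere) and the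
# single-bond test field `A = δ_b·h`; every plaquette through `b` has plaquette variable `−1`, `⟨δ_b h, J⟩_τ = Re τ(h* J(b))`, the principal part
# `(D^{η*}_{U₀}D^η_{U₀} δ_b h)(b) = 2(d−1)η⁻²·h`, and the divergence `D^{η*}_{U₀}δ_b h` lives on the two end-points of `b`

statement-level skeleton of published theorems with citation tags; proofs where landed; nothing here is a claim about the
Yang–Mills mass gap

`[Balaban1985BackgroundPropagators]` ("B9", CMP **99** (1985) 389–434; journal page = PDF page + 388): (3.1)–(3.5) pp. 390–391 (plaquette variables, the
plaquette covariant derivative «(D^η_U A)(p) = η⁻¹(A(x,y) + R(U(x,y))A(y,z) + R(U(x,w))A(z,w) + A(w,x))»), (3.9)–(3.10) p. 392 («Δ = D*D + Δ′»), (3.26)–(3.27)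
p. 395, (3.35) p. 396, Thm 3.11 p. 416.  `[Balaban1985RegularSpaces]` ("B8", CMP **99** (1985) 75–102): (1.1)–(1.2) p. 76 (the two covariant derivatives and the
divergence), (1.55) p. 86 (`J = D^{η*}_{U₀}D^η_{U₀}A`), p. 77 (bond∕plaquette TOUCHING convention).  PDF held: `paper:balaban1985-cmp99-background-propagators`.

CITATION HEADER ∕ WHY THIS FILE (cell `pub-ymgap`, HUMAN RULING D-0062 ∕ D-0149; width seat `pub-ymgap-dag-n06-w3` (g5), node N06 = [B9]; CLAIM-1 file 1∕3;
count-neutral).  dag-n06-b g20's LOCATED-SELF-7 (bus; premise certified in kernel by `B9Eq335CollarBlindCubeZd`, p627199): at a `cubeFam false` member the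
frame's class (3.35) does not read the collar bonds of `□₀`, so it contains backgrounds with a plaquette variable `−1` touching `□₀`; the SIGN half — that the
genuine four-letter `Δ_a(U₀)` of the junction is then INDEFINITE on `E_𝔤(□₀)` — was left «typable if a referee wants it».  This lineage (Thm 3.11 at the `ℤᵈ`
carrier, g3∕g4) types it in three files; THIS file is the elementary lattice algebra of the witness: the CROSSING-BOND TWIST (`U₀ = −1` on one bond `b` based
OUTSIDE `Ω₀` with its far end inside) and the test field `δ_b h`, read through the tree's `ℤᵈ` letters `plaqF` ∕ `plaqCovDeriv` ∕ `Jcur` ∕ `covDivB` by direct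
evaluation (no summation by parts).  File 2 (`B9Eq310TwistedBondDeltaPrimeZd`) does the curvature letter `Δ′(U₀)` of (3.10); file 3
(`B9Thm311IndefiniteInFrameClassCubeZd`) assembles the negative form and the frame-level statements.

WHAT IS PROVED (kernel, 0 sorry; theorems only — no `def`, `instance`, `notation`).
* §0 `add_e_ne_self`, `sub_e_ne_self`, `sub_e_add_e_eq_self_iff` (unit vectors move every site); private `conjR_zero'`, `neg_one_mem_unitaryUnits'`.
* §1 the twist `U₀ y κ = if (y, κ) = (z, ν) then −1 else 1` (hypothesis `hU`) and the field `A y κ = if (y, κ) = (z, ν) then h else 0` (hypothesis `hA`):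
  `twist_mem_unitaryUnits`, `twist_self ∕ twist_of_ne ∕ twist_of_site_ne ∕ twist_of_dir_ne`, ★ `plaqF_twist_at` (`U₀(∂p_{κν}(z)) = −1`, `κ ≠ ν`),
  `single_self ∕ single_of_ne ∕ …`, `single_mem_domSub ∕ single_mem_domSubH` (`δ_b h ∈ E_𝔤(Ω₀)` when `z + e_ν ∈ Ω₀`, `h` Hermitian), `single_ne_zero`,
  ★ `bondPair_single_left` (`⟨δ_b h, J⟩_τ = Re τ(h* J(b))` for EVERY `J`).
* §2 `card_Iio_add_card_Ioi` (`#{κ<ν} + #{κ>ν} = d − 1`), the four plaquette derivatives (3.4) of `δ_b h` around `b` (`plaqCovDeriv_single₁…₄`: `±η⁻¹h`),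
  ★★ `Jcur_twist_single` (`(D^{η*}_{U₀}D^η_{U₀}δ_b h)(b) = (d−1)·2η⁻²·h` — transports to a plaquette and back cancel), `support_single_finite`,
  ★ `covDivB_single_far` (`(D^{η*}_{U₀}δ_b h)(z + e_ν) = η⁻¹h`), `covDivB_single_of_ne` (`= 0` off the two end-points).

HONEST SCOPE.  Finite lattice bookkeeping on one explicit background and one explicit field; no estimate of [B9]; nothing of Thm 3.11 is asserted here (the
sign statement is file 3's); count-neutral helper of K1⁹ (`--supports stmt-QuantumFields-27364`); N05 ∕ N06 NOT discharged; one finite `𝕋⁴` programme at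
fixed `ε`, Bałaban as printed; R4 closes only the conditional finite-`𝕋⁴` rung `BalabanLadder.UV` — nothing continuum ∕ `ℝ⁴` ∕ OS ∕ mass gap ∕ Clay.  Unit
`pub-ymgap-dag-n06-w3` (g5), 2026-08-28.
-/

noncomputable section

open scoped BigOperators
open NormedSpace

namespace Literature.MathematicalPhysics.QuantumFieldTheory.Balaban1983to89.B9Eq310TwistedBondDstarDZd

open B7Prop1Explicit (e hol plaqWord U1)
open B7Prop2Explicit (unitaryUnits unitaryUnits_le_U1)
open B7Eq78Linearization (conjR)
open B8Ineq132 (PlaqTouches BondTouches plaqF covDeriv covDerivFwd)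
open B8Eq138LandauZd (covDivB)
open B8Eq155JBound (Jcur)
open B8Eq146AExpansion (plaqCovDeriv lin X1 X2 X3 X4)
open B8Eq143PlaqExpansion (pdiv)
open B9Eq335PlaquettesOfRegularCubeZd (hol_plaqWord_eq)
open B9Eq327GreenZd (domSub bondPair)
open B9Eq327GreenZdHerm (domSubH)

export B7Prop1Explicit (Site)

variable {d : ℕ}

/-! ## §0  Lattice bookkeeping: the unit vectors move every site -/

section Sites

/-- `z + e_κ ≠ z`. [cite: Balaban1985RegularSpaces, (1.1) p.76 (bookkeeping)] -/
theorem add_e_ne_self (z : Site d) (κ : Fin d) : z + e κ ≠ z := by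
  intro h
  have := congrArg (fun v => v κ) h
  simp [B7Prop1Explicit.e_apply] at this

/-- `z − e_κ ≠ z`. [cite: Balaban1985RegularSpaces, (1.1) p.76 (bookkeeping)] -/
theorem sub_e_ne_self (z : Site d) (κ : Fin d) : z - e κ ≠ z := by
  intro h
  have := congrArg (fun v => v κ) h
  simp [B7Prop1Explicit.e_apply] at this

/-- `z − e_κ + e_ν = z` iff `κ = ν`. [cite: Balaban1985RegularSpaces, (1.1) p.76 (bookkeeping)] -/
theorem sub_e_add_e_eq_self_iff (z : Site d) (κ ν : Fin d) : z - e κ + e ν = z ↔ κ = ν := by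
  constructor
  · intro h
    by_contra hne
    have := congrArg (fun v => v κ) h
    simp [B7Prop1Explicit.e_apply, hne] at this
  · rintro rfl; abel

end Sites

section ConjR

variable {𝔸 : Type*} [CStarAlgebra 𝔸]

/-- `R(X)0 = 0`. [cite: Balaban1985BackgroundPropagators, (3.3) p.390 (bookkeeping)] -/
private theorem conjR_zero' (X : 𝔸ˣ) : conjR X (0 : 𝔸) = 0 := by
  simp [conjR]

/-- `−1` is a unitary unit. [cite: Balaban1985BackgroundPropagators, p.390 («unitary group U(N)», bookkeeping)] -/
private theorem neg_one_mem_unitaryUnits' : (-1 : 𝔸ˣ) ∈ unitaryUnits 𝔸 := by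
  show (((-1 : 𝔸ˣ)) : 𝔸) ∈ unitary 𝔸
  rw [Units.val_neg, Units.val_one, Unitary.mem_iff]
  simp

end ConjR

/-! ## §1  The crossing-bond twist and the single-bond test field -/

section Twist

variable {𝔸 : Type*} [CStarAlgebra 𝔸]

variable (z : Site d) (ν : Fin d)

/-- the twist is unitary. [cite: Balaban1985BackgroundPropagators, p.390 (bookkeeping)] -/
theorem twist_mem_unitaryUnits {U₀ : Site d → Fin d → 𝔸ˣ} (hU : ∀ y κ, U₀ y κ = if y = z ∧ κ = ν then -1 else 1) (y : Site d) (κ : Fin d) :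
    U₀ y κ ∈ unitaryUnits 𝔸 := by
  rw [hU]
  split_ifs
  · exact neg_one_mem_unitaryUnits'
  · exact (unitaryUnits 𝔸).one_mem

/-- the twist off the crossing bond. [cite: Balaban1985BackgroundPropagators, (3.35) p.396 (bookkeeping)] -/
theorem twist_of_ne {U₀ : Site d → Fin d → 𝔸ˣ} (hU : ∀ y κ, U₀ y κ = if y = z ∧ κ = ν then -1 else 1) {y : Site d} {κ : Fin d}
    (h : ¬ (y = z ∧ κ = ν)) : U₀ y κ = 1 := by
  rw [hU, if_neg h]

/-- the twist at the crossing bond. [cite: Balaban1985BackgroundPropagators, (3.35) p.396 (bookkeeping)] -/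
theorem twist_self {U₀ : Site d → Fin d → 𝔸ˣ} (hU : ∀ y κ, U₀ y κ = if y = z ∧ κ = ν then -1 else 1) : U₀ z ν = -1 := by
  rw [hU, if_pos ⟨rfl, rfl⟩]

/-- off the site `z` the twist is `1`. [cite: Balaban1985BackgroundPropagators, (3.35) p.396 (bookkeeping)] -/
theorem twist_of_site_ne {U₀ : Site d → Fin d → 𝔸ˣ} (hU : ∀ y κ, U₀ y κ = if y = z ∧ κ = ν then -1 else 1) {y : Site d} (hy : y ≠ z)
    (κ : Fin d) : U₀ y κ = 1 :=
  twist_of_ne z ν hU fun h => hy h.1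

/-- off the direction `ν` the twist is `1`. [cite: Balaban1985BackgroundPropagators, (3.35) p.396 (bookkeeping)] -/
theorem twist_of_dir_ne {U₀ : Site d → Fin d → 𝔸ˣ} (hU : ∀ y κ, U₀ y κ = if y = z ∧ κ = ν then -1 else 1) (y : Site d) {κ : Fin d}
    (hκ : κ ≠ ν) : U₀ y κ = 1 :=
  twist_of_ne z ν hU fun h => hκ h.2

/-- ★ **EVERY PLAQUETTE THROUGH THE TWISTED BOND HAS PLAQUETTE VARIABLE `−1`** (first family: `p_{κν}(z)`, `κ ≠ ν`).
[cite: Balaban1985RegularSpaces, (1.2) p.76; Balaban1985BackgroundPropagators, (3.1) p.390] -/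
theorem plaqF_twist_at {U₀ : Site d → Fin d → 𝔸ˣ} (hU : ∀ y κ, U₀ y κ = if y = z ∧ κ = ν then -1 else 1) {κ : Fin d} (hκ : κ ≠ ν) :
    plaqF U₀ κ ν z = -1 := by
  unfold plaqF
  rw [hol_plaqWord_eq, twist_of_dir_ne z ν hU z hκ, twist_of_site_ne z ν hU (add_e_ne_self z κ) ν,
    twist_of_dir_ne z ν hU (z + e ν) hκ, twist_self z ν hU]
  simp

variable (h : 𝔸)

/-- off the crossing bond the test field vanishes. [cite: Balaban1985BackgroundPropagators, (3.27) p.395 (bookkeeping)] -/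
theorem single_of_ne {A : Site d → Fin d → 𝔸} (hA : ∀ y κ, A y κ = if y = z ∧ κ = ν then h else 0) {y : Site d} {κ : Fin d}
    (h' : ¬ (y = z ∧ κ = ν)) : A y κ = 0 := by
  rw [hA, if_neg h']

/-- the test field at the crossing bond. [cite: Balaban1985BackgroundPropagators, (3.27) p.395 (bookkeeping)] -/
theorem single_self {A : Site d → Fin d → 𝔸} (hA : ∀ y κ, A y κ = if y = z ∧ κ = ν then h else 0) : A z ν = h := by
  rw [hA, if_pos ⟨rfl, rfl⟩]

/-- off the site `z` the test field vanishes. [cite: Balaban1985BackgroundPropagators, (3.27) p.395 (bookkeeping)] -/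
theorem single_of_site_ne {A : Site d → Fin d → 𝔸} (hA : ∀ y κ, A y κ = if y = z ∧ κ = ν then h else 0) {y : Site d} (hy : y ≠ z)
    (κ : Fin d) : A y κ = 0 :=
  single_of_ne z ν h hA fun h' => hy h'.1

/-- off the direction `ν` the test field vanishes. [cite: Balaban1985BackgroundPropagators, (3.27) p.395 (bookkeeping)] -/
theorem single_of_dir_ne {A : Site d → Fin d → 𝔸} (hA : ∀ y κ, A y κ = if y = z ∧ κ = ν then h else 0) (y : Site d) {κ : Fin d}
    (hκ : κ ≠ ν) : A y κ = 0 :=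
  single_of_ne z ν h hA fun h' => hκ h'.2

/-- the test field lies in `E(Ω₀)` as soon as the far end `z + e_ν` of the crossing bond lies in `Ω₀`. [cite: Balaban1985BackgroundPropagators, (3.27) p.395; Balaban1985RegularSpaces, p.77 (bond convention)] -/
theorem single_mem_domSub {Ω₀ : Set (Site d)} (hx₀ : z + e ν ∈ Ω₀) {A : Site d → Fin d → 𝔸}
    (hA : ∀ y κ, A y κ = if y = z ∧ κ = ν then h else 0) : A ∈ domSub (𝔸 := 𝔸) Ω₀ := by
  intro y κ hb
  rw [hA]
  split_ifs with hyk
  · exact absurd (Or.inr (by rw [hyk.1, hyk.2]; exact hx₀)) hb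
  · rfl

/-- … and in `E_𝔤(Ω₀)` when `h` is Hermitian. [cite: Balaban1985BackgroundPropagators, p.391 («hermitian matrices»), (3.27) p.395] -/
theorem single_mem_domSubH {Ω₀ : Set (Site d)} (hx₀ : z + e ν ∈ Ω₀) (hh : IsSelfAdjoint h) {A : Site d → Fin d → 𝔸}
    (hA : ∀ y κ, A y κ = if y = z ∧ κ = ν then h else 0) : A ∈ domSubH (𝔸 := 𝔸) Ω₀ := by
  refine ⟨single_mem_domSub z ν h hx₀ hA, fun y κ => ?_⟩
  rw [hA]
  split_ifs
  · exact hh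
  · exact IsSelfAdjoint.zero _

/-- the test field is non-zero when `h ≠ 0`. [cite: Balaban1985BackgroundPropagators, (3.27) p.395 (bookkeeping)] -/
theorem single_ne_zero (hh : h ≠ 0) {A : Site d → Fin d → 𝔸} (hA : ∀ y κ, A y κ = if y = z ∧ κ = ν then h else 0) : A ≠ 0 := by
  intro h0
  have := single_self z ν h hA
  rw [h0, Pi.zero_apply, Pi.zero_apply] at this
  exact hh this.symm

variable (τ : 𝔸 →ₗ[ℂ] ℂ)

/-- ★ **THE PAIRING AGAINST A SINGLE-BOND FIELD READS ONE VALUE**: `⟨δ_b h, J⟩_τ = Re τ(h* J(b))` for EVERY bond field `J`.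
[cite: Balaban1985BackgroundPropagators, (3.17) p.393, p.391 («X·Y = tr XY»)] -/
theorem bondPair_single_left {A : Site d → Fin d → 𝔸} (hA : ∀ y κ, A y κ = if y = z ∧ κ = ν then h else 0) (J : Site d → Fin d → 𝔸) :
    bondPair τ A J = (τ (star h * J z ν)).re := by
  classical
  unfold bondPair
  have hterm : ∀ (μ : Fin d) (x : Site d), (τ (star (A x μ) * J x μ)).re = if x = z ∧ μ = ν then (τ (star h * J z ν)).re else 0 := by
    intro μ x
    rw [hA]
    split_ifs with hx
    · rw [hx.1, hx.2]
    · rw [star_zero, zero_mul, map_zero, Complex.zero_re]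
  simp_rw [hterm]
  have hfin : ∀ μ : Fin d, ∑ᶠ x, (if x = z ∧ μ = ν then (τ (star h * J z ν)).re else 0) = if μ = ν then (τ (star h * J z ν)).re else 0 := by
    intro μ
    by_cases hμ : μ = ν
    · rw [if_pos hμ]
      rw [finsum_eq_single _ z (fun x hx => by rw [if_neg (fun h' => hx h'.1)])]
      rw [if_pos ⟨rfl, hμ⟩]
    · rw [if_neg hμ]
      exact finsum_eq_zero_of_forall_eq_zero fun x => by rw [if_neg (fun h' => hμ h'.2)]
  simp_rw [hfin]
  rw [Finset.sum_ite_eq' Finset.univ ν, if_pos (Finset.mem_univ ν)]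

end Twist

section Letters

variable {𝔸 : Type*} [CStarAlgebra 𝔸]
variable (z : Site d) (ν : Fin d) (h : 𝔸) (η : ℝ)
variable {U₀ : Site d → Fin d → 𝔸ˣ} (hU : ∀ y κ, U₀ y κ = if y = z ∧ κ = ν then -1 else 1)
variable {A : Site d → Fin d → 𝔸} (hA : ∀ y κ, A y κ = if y = z ∧ κ = ν then h else 0)

/-- `#{κ < ν} + #{κ > ν} = d − 1`: the number of plaquette orientations through a bond. [cite: Balaban1985BackgroundPropagators, (3.9) p.392 (bookkeeping)] -/
theorem card_Iio_add_card_Ioi (ν : Fin d) : (Finset.Iio ν).card + (Finset.Ioi ν).card = d - 1 := by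
  rw [Fin.card_Iio, Fin.card_Ioi]
  omega

/-! ### (a) `D*D`: the plaquette derivative (3.4) of the test field and its divergence at `b` -/

include hU hA in
/-- `(D^η_{U₀}A)(p_{κν}(z − e_κ)) = η⁻¹h`, `κ ≠ ν`. [cite: Balaban1985BackgroundPropagators, (3.4) p.391] -/
theorem plaqCovDeriv_single₁ {κ : Fin d} (hκ : κ ≠ ν) : plaqCovDeriv η U₀ A κ ν (z - e κ) = η⁻¹ • h := by
  have h1 : A (z - e κ) κ = 0 := single_of_dir_ne z ν h hA _ hκ
  have h2 : A (z - e κ + e κ) ν = h := by rw [sub_add_cancel]; exact single_self z ν h hA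
  have h3 : A (z - e κ + e ν) κ = 0 := single_of_dir_ne z ν h hA _ hκ
  have h4 : A (z - e κ) ν = 0 := single_of_site_ne z ν h hA (sub_e_ne_self z κ) ν
  have hu : U₀ (z - e κ) κ = 1 := twist_of_dir_ne z ν hU _ hκ
  simp only [plaqCovDeriv, lin, X1, X2, X3, X4, h1, h2, h3, h4, hu, B8Ineq132.one_conjR, neg_zero, conjR_zero', zero_add,
    add_zero]

include hA in
/-- `(D^η_{U₀}A)(p_{κν}(z)) = −η⁻¹h`, `κ ≠ ν`. [cite: Balaban1985BackgroundPropagators, (3.4) p.391] -/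
theorem plaqCovDeriv_single₂ {κ : Fin d} (hκ : κ ≠ ν) : plaqCovDeriv η U₀ A κ ν z = -(η⁻¹ • h) := by
  have h1 : A z κ = 0 := single_of_dir_ne z ν h hA _ hκ
  have h2 : A (z + e κ) ν = 0 := single_of_site_ne z ν h hA (add_e_ne_self z κ) ν
  have h3 : A (z + e ν) κ = 0 := single_of_dir_ne z ν h hA _ hκ
  have h4 : A z ν = h := single_self z ν h hA
  simp only [plaqCovDeriv, lin, X1, X2, X3, X4, h1, h2, h3, h4, neg_zero, conjR_zero', zero_add, smul_neg]

include hU hA in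
/-- `(D^η_{U₀}A)(p_{νκ}(z − e_κ)) = −η⁻¹h`, `κ ≠ ν`. [cite: Balaban1985BackgroundPropagators, (3.4) p.391, (3.5) p.391] -/
theorem plaqCovDeriv_single₃ {κ : Fin d} (hκ : κ ≠ ν) : plaqCovDeriv η U₀ A ν κ (z - e κ) = -(η⁻¹ • h) := by
  have h1 : A (z - e κ) ν = 0 := single_of_site_ne z ν h hA (sub_e_ne_self z κ) ν
  have h2 : A (z - e κ + e ν) κ = 0 := single_of_dir_ne z ν h hA _ hκ
  have h3 : A (z - e κ + e κ) ν = h := by rw [sub_add_cancel]; exact single_self z ν h hA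
  have h4 : A (z - e κ) κ = 0 := single_of_dir_ne z ν h hA _ hκ
  have hu : U₀ (z - e κ) κ = 1 := twist_of_dir_ne z ν hU _ hκ
  simp only [plaqCovDeriv, lin, X1, X2, X3, X4, h1, h2, h3, h4, hu, B8Ineq132.one_conjR, neg_zero, conjR_zero', zero_add,
    add_zero, smul_neg]

include hA in
/-- `(D^η_{U₀}A)(p_{νκ}(z)) = η⁻¹h`, `κ ≠ ν`. [cite: Balaban1985BackgroundPropagators, (3.4) p.391, (3.5) p.391] -/
theorem plaqCovDeriv_single₄ {κ : Fin d} (hκ : κ ≠ ν) : plaqCovDeriv η U₀ A ν κ z = η⁻¹ • h := by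
  have h1 : A z ν = h := single_self z ν h hA
  have h2 : A (z + e ν) κ = 0 := single_of_dir_ne z ν h hA _ hκ
  have h3 : A (z + e κ) ν = 0 := single_of_site_ne z ν h hA (add_e_ne_self z κ) ν
  have h4 : A z κ = 0 := single_of_dir_ne z ν h hA _ hκ
  simp only [plaqCovDeriv, lin, X1, X2, X3, X4, h1, h2, h3, h4, neg_zero, conjR_zero', add_zero]

include hU hA in
/-- ★ **THE `D*D` LETTER AT THE TWISTED BOND**: `(D^{η*}_{U₀}D^η_{U₀}δ_b h)(b) = 2(d−1)η⁻²·h` — each of the `2(d−1)` plaquettes through `b` returns `η⁻²h`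
(the transports to the plaquette and back cancel). [cite: Balaban1985RegularSpaces, (1.55) p.86, (1.1)–(1.2) p.76; Balaban1985BackgroundPropagators, (3.9)–(3.10) p.392] -/
theorem Jcur_twist_single : Jcur η U₀ A ν z = ((d - 1 : ℕ) : ℝ) • ((2 * (η⁻¹ * η⁻¹)) • h) := by
  have hIio : ∀ κ ∈ Finset.Iio ν, covDeriv η U₀ κ (plaqCovDeriv η U₀ A κ ν) z = (2 * (η⁻¹ * η⁻¹)) • h := by
    intro κ hκ
    have hκ' : κ ≠ ν := (Finset.mem_Iio.mp hκ).ne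
    have hu : U₀ (z - e κ) κ = 1 := twist_of_dir_ne z ν hU _ hκ'
    rw [covDeriv, hu, inv_one, B8Ineq132.one_conjR, plaqCovDeriv_single₁ z ν h η hU hA hκ', plaqCovDeriv_single₂ z ν h η hA hκ']
    module
  have hIoi : ∀ κ ∈ Finset.Ioi ν, covDeriv η U₀ κ (plaqCovDeriv η U₀ A ν κ) z = -((2 * (η⁻¹ * η⁻¹)) • h) := by
    intro κ hκ
    have hκ' : κ ≠ ν := (Finset.mem_Ioi.mp hκ).ne'
    have hu : U₀ (z - e κ) κ = 1 := twist_of_dir_ne z ν hU _ hκ'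
    rw [covDeriv, hu, inv_one, B8Ineq132.one_conjR, plaqCovDeriv_single₃ z ν h η hU hA hκ', plaqCovDeriv_single₄ z ν h η hA hκ']
    module
  rw [Jcur, pdiv, Finset.sum_congr rfl hIio, Finset.sum_congr rfl hIoi, Finset.sum_const, Finset.sum_const, smul_neg, sub_neg_eq_add,
    ← add_nsmul, card_Iio_add_card_Ioi, ← Nat.cast_smul_eq_nsmul ℝ]


/-! ### (b) `D*`: the divergence of the test field lives on the two end-points of `b` -/

include hA in
/-- the components of the test field are finitely supported (on `{z}`). [cite: Balaban1985BackgroundPropagators, (3.27) p.395 (bookkeeping)] -/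
theorem support_single_finite (μ : Fin d) : (Function.support fun x => A x μ).Finite := by
  refine (Set.finite_singleton z).subset fun x hx => ?_
  rw [Function.mem_support] at hx
  by_contra hxz
  exact hx (single_of_site_ne z ν h hA hxz μ)

include hU hA in
/-- `(D^{η*}_{U₀}δ_b h)(z + e_ν) = η⁻¹h` — the divergence of the test field at the FAR end of the crossing bond (transport by `(−1)⁻¹` is trivial).
[cite: Balaban1985RegularSpaces, (1.1) p.76, (1.38) p.82] -/
theorem covDivB_single_far : covDivB η U₀ A (z + e ν) = η⁻¹ • h := by
  classical
  have hterm : ∀ μ : Fin d, covDeriv η U₀ μ (fun y => A y μ) (z + e ν) = if μ = ν then η⁻¹ • h else 0 := by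
    intro μ
    by_cases hμ : μ = ν
    · subst hμ
      rw [if_pos rfl, covDeriv, add_sub_cancel_right, twist_self z μ hU, single_self z μ h hA,
        single_of_site_ne z μ h hA (add_e_ne_self z μ) μ, sub_zero, inv_neg_one]
      simp [conjR]
    · rw [if_neg hμ, covDeriv, single_of_dir_ne z ν h hA _ hμ, single_of_dir_ne z ν h hA _ hμ, conjR_zero', sub_zero, smul_zero]
  rw [covDivB, Finset.sum_congr rfl fun μ _ => hterm μ, Finset.sum_ite_eq' Finset.univ ν, if_pos (Finset.mem_univ ν)]

include hA in
/-- `(D^{η*}_{U₀}δ_b h)(x) = 0` at every site `x` other than the two end-points of `b`. [cite: Balaban1985RegularSpaces, (1.1) p.76, (1.38) p.82] -/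
theorem covDivB_single_of_ne {x : Site d} (hx : x ≠ z) (hx' : x ≠ z + e ν) : covDivB η U₀ A x = 0 := by
  refine Finset.sum_eq_zero fun μ _ => ?_
  have h0 : A x μ = 0 := single_of_site_ne z ν h hA hx μ
  have h1 : A (x - e μ) μ = 0 := by
    by_cases hμ : μ = ν
    · subst hμ
      exact single_of_site_ne z μ h hA (fun h' => hx' (by rw [← h', sub_add_cancel])) μ
    · exact single_of_dir_ne z ν h hA _ hμ
  rw [covDeriv, h0, h1, conjR_zero', sub_zero, smul_zero]


end Letters

end Literature.MathematicalPhysics.QuantumFieldTheory.Balaban1983to89.B9Eq310TwistedBondDstarDZd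

end
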